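import Literature.IUT.LogVolume.TensorPacketFactorDifferent
import HarnessLib

/-!
# The differents of the factor fields `L_J` of a tensor packet `⊗_{ℚ_p} k_i ≅ ∏_J L_J`:
# `d_{L_J} ≤ d_I` for every `J`, and `min_J d_{L_J} ≤ d_Ω` for every field `Ω` receiving all the `k_i`
# ([IUTchIV] Prop. 1.1 / 1.4 (i); Dupuy–Hilado §4.12 — the term `d_{L_J}` of the sharp lower window)

abc-iut cell, campaign-S seat abc-iut-S4 (gen 6). Sequel to abc-iut-w6-d018's R2 TARGET #1 «Rest_lower»
(`TensorPacketDifferentSharp` / `TensorPacketContentSharp` / `TensorPacketFactorDifferent` /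
`Summits/ABC/IUTFork/ForkGenuineWindowSharp`): there the genuine `−|log(Θ)|` is bounded BELOW by
`−ndegLgpSlotMin + D♯` with `D♯ = Σ_p (1/ℓ⋇) Σ_j Σ_{v⃗} (d_I(v⃗) − min_J d_{L_J}(v⃗))·log p·Π Pr`, the different
`d_{L_J}(v⃗)` of the factor fields of the packet `⊗_b K_{v̲_b}` being EVALUATED (`= d_v`) when all the slots carry ONE
NORMAL completion (`TensorPacketFactorDifferent.differentOrd_dFac_eq_of_normal`) and otherwise only bounded BELOW
(`d_i ≤ d_{L_J}`). HERE the complementary UPPER bounds on `min_J d_{L_J}` — the direction the LOWER window needs —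
for ARBITRARY factor fields, in particular for the MIXED collections `v⃗` (distinct places `v_b` over `p`), which
carry almost all of Dupuy–Hilado's weight `Π Pr(v_b)`:

* `differentOrd_le_of_algHom` — a `ℚ_p`-embedding `τ : L → Ω` of `p`-adic fields (the cell's norm-side class)
  gives `d_L ≤ d_Ω` (w6-d018's `differentOrd_le_of_isometry`; every such `τ` IS an isometry, abc-iut-S8's
  `norm_map_algHom`);
* `exists_apply_eq_apply_single_of_algHom_pi` — an algebra homomorphism from a finite product of fields
  `∏_J L_J` to a field `Ω` factors through ONE projection (it kills all but one of the idempotents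
  `(0,…,1,…,0)`); `exists_nonempty_algHom_of_algHom_pi` — the induced embedding `L_{J₀} → Ω` (both `private`
  plumbing);
* **`exists_differentOrd_dFac_le_of_algHom`** — for ANY `p`-adic field `Ω` and `ℚ_p`-embeddings
  `φ_i : k_i → Ω` of ALL the factors there is a factor field `L_J` of the packet with `d_{L_J} ≤ d_Ω` (the
  homomorphism `⊗φ_i ∘ ψ⁻¹ : ∏_J L_J → Ω` factors through some `L_{J₀} ↪ Ω`); `inf_differentOrd_dFac_le_of_algHom` —
  hence `min_J d_{L_J} ≤ d_Ω`. Two instances: (a) a CONSTANT family `k_i = K` (`j+1` copies of ONE completion,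
  Galois or not): `min_J d_{L_J} ≤ d_K` (`inf_differentOrd_dFac_const_le`); (b) a family drawn from a finite stock
  `k = k₁ ∘ e` (`e : I → U`, e.g. a collection `v⃗` of places over `p` drawn from `V(F₀)_p`): `min_J d_{L_J} ≤`
  the different of ANY factor field of the one-copy packet `⊗_{u∈U} k₁ u` (`inf_differentOrd_dFac_comp_le_dFac`);
* **`differentOrd_dFac_le_dSum`** — for EVERY factor field: `d_{L_J} ≤ d_I = Σ_i d_i` (trace duality read the
  other way: for a generator `g_J` of `𝔇_{L_J}` the element `x = ψ⁻¹(0,…,g_J⁻¹,…,0)` pairs integrally with `R_I`,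
  so its coordinates in the tensor basis DUAL to an integral tensor basis lie in `ℤ_p`, whence `(⊗δ_i)·x ∈ R_I ⊆
  (R_I)^∼` and `∏‖δ_i‖·‖g_J‖⁻¹ ≤ 1`); with (b): **`inf_differentOrd_dFac_comp_le_dSum`** —
  `min_J d_{L_J}(k₁ ∘ e) ≤ Σ_{u∈U} d(k₁ u)`, uniformly in the collection `e`.

So in `D♯` every collection `v⃗ ∈ V(F₀)_p^{j+1}` contributes at least `(Σ_b d_{v_b} − Σ_{u|p} d_u)·log p`: the
full `(ℓ⋇+3)/2 · Σ_u Pr(u)·d_u` of [IUTchIV] Thm. 1.10 Step (v)'s different budget is realised by the genuine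
volume up to ONE unweighted copy `Σ_{u|p} d_u` per prime (sequel, summit-side). Classical local algebra
(Dedekind's different and duality; structure of finite étale `ℚ_p`-algebras); the [IUTchIV] tags record the
cell's typing. [cite: Mochizuki2012, IUTchIV Prop. 1.1 p. 9, Prop. 1.4 (i) p. 13]
[cite: SerreLocalFields1979, Ch. III §3, §6] No side taken on [IUTchIII] Cor. 3.12
[claim: Mochizuki2012, status: disputed]. PROOF-ONLY file: no definitions, no named `Prop` facts.
-/

noncomputable section

open Set Module Function
open scoped Pointwise TensorProduct NormedField nonZeroDivisors

namespace Literature.IUT.LogVolume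

/-! ## The different does not decrease along an embedding of `p`-adic fields -/

section Embedding

variable {p : ℕ} [Fact p.Prime]
variable {L : Type} [NontriviallyNormedField L] [NormedAlgebra ℚ_[p] L] [IsUltrametricDist L] [ProperSpace L]
variable {Ω : Type} [NontriviallyNormedField Ω] [NormedAlgebra ℚ_[p] Ω] [IsUltrametricDist Ω] [ProperSpace Ω]

/-- **`d_L ≤ d_Ω` along ANY `ℚ_p`-embedding `τ : L → Ω`** of `p`-adic fields: `τ` is an isometry
(`norm_map_algHom`), so w6-d018's `differentOrd_le_of_isometry` ([IUTchIV] Prop. 1.3 (i) / abc-iut-L5-t15's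
`differentOrd_base_le` along the normed-algebra structure through `τ`) applies.
[cite: Mochizuki2012, IUTchIV Prop. 1.3 (i) p. 11] -/
theorem differentOrd_le_of_algHom (τ : L →ₐ[ℚ_[p]] Ω) : differentOrd p L ≤ differentOrd p Ω :=
  differentOrd_le_of_isometry p τ (norm_map_algHom τ)

end Embedding

/-! ## An algebra homomorphism from a finite product of fields to a field factors through one projection -/

section PiFactor

variable {R : Type*} [CommSemiring R] {J : Type*} [Fintype J] [DecidableEq J]
variable {L : J → Type*} [∀ j, Field (L j)] [∀ j, Algebra R (L j)]
variable {Ω : Type*} [Field Ω] [Algebra R Ω]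

/-- **A homomorphism `g : ∏_J L_J → Ω` into a field factors through ONE coordinate**: there is `J₀` with
`g(y) = g(0,…,y_{J₀},…,0)` for all `y` (the images of the idempotents `e_J = (0,…,1,…,0)` are idempotents of the
field `Ω`, i.e. `0` or `1`; they sum to `g(1) = 1`, so one of them is `1`, and `e_{J₀}·y = (0,…,y_{J₀},…,0)`).
[folklore] -/
private theorem exists_apply_eq_apply_single_of_algHom_pi (g : (Π j, L j) →ₐ[R] Ω) :
    ∃ J₀ : J, g (Pi.single J₀ 1) = 1 ∧ ∀ y : Π j, L j, g y = g (Pi.single J₀ (y J₀)) := by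
  -- some idempotent `e_J` is not killed
  have hsum : ∑ j, g (Pi.single j (1 : L j)) = 1 := by
    rw [← map_sum, Finset.univ_sum_single (fun _ : J => (1 : L _))]
    exact map_one g
  obtain ⟨J₀, -, hJ₀⟩ : ∃ j ∈ (Finset.univ : Finset J), g (Pi.single j (1 : L j)) ≠ 0 := by
    by_contra h
    push Not at h
    rw [Finset.sum_eq_zero h] at hsum
    exact zero_ne_one hsum
  -- hence it goes to `1`
  have hidem : IsIdempotentElem (g (Pi.single J₀ (1 : L J₀))) := by
    rw [IsIdempotentElem, ← map_mul, ← Pi.single_mul, mul_one]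
  have hone : g (Pi.single J₀ (1 : L J₀)) = 1 :=
    (IsIdempotentElem.iff_eq_zero_or_one.mp hidem).resolve_left hJ₀
  refine ⟨J₀, hone, fun y => ?_⟩
  have hy : Pi.single J₀ (y J₀) = Pi.single J₀ (1 : L J₀) * y := by
    ext j
    by_cases hj : j = J₀
    · subst hj; simp
    · simp [Pi.single_eq_of_ne hj]
  rw [hy, map_mul, hone, one_mul]

/-- **Some factor `L_{J₀}` embeds in `Ω`**: the map `a ↦ g(0,…,a,…,0)` through the coordinate `J₀` of
`exists_apply_eq_apply_single_of_algHom_pi` is an `R`-algebra homomorphism `L_{J₀} → Ω` (of fields, hence an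
embedding). [folklore] -/
private theorem exists_nonempty_algHom_of_algHom_pi (g : (Π j, L j) →ₐ[R] Ω) : ∃ J₀ : J, Nonempty (L J₀ →ₐ[R] Ω) := by
  obtain ⟨J₀, hJ₀, -⟩ := exists_apply_eq_apply_single_of_algHom_pi g
  have h1 : ∀ r : R, (Pi.single J₀ (algebraMap R (L J₀) r) : Π j, L j) = r • Pi.single J₀ (1 : L J₀) := by
    intro r
    ext j
    by_cases hj : j = J₀
    · subst hj; simp [Algebra.algebraMap_eq_smul_one]
    · simp [Pi.single_eq_of_ne hj]
  let τ₀ : L J₀ →+* Ω :=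
    { toFun := fun a => g (Pi.single J₀ a)
      map_one' := hJ₀
      map_mul' := fun a b => by simp only [Pi.single_mul, map_mul]
      map_zero' := by simp only [Pi.single_zero, map_zero]
      map_add' := fun a b => by simp only [Pi.single_add, map_add] }
  have hτ₀ : ∀ a, τ₀ a = g (Pi.single J₀ a) := fun a => rfl
  refine ⟨J₀, ⟨{ τ₀ with commutes' := fun r => ?_ }⟩⟩
  change τ₀ (algebraMap R (L J₀) r) = algebraMap R Ω r
  rw [hτ₀, h1, map_smul, hJ₀, Algebra.algebraMap_eq_smul_one]

end PiFactor

/-! ## The factor fields of a tensor packet -/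

section Packet

variable (p : ℕ) [Fact p.Prime]
variable {I : Type} [Fintype I] [DecidableEq I] [Nonempty I]
variable (k : I → Type) [∀ i, NontriviallyNormedField (k i)] [∀ i, NormedAlgebra ℚ_[p] (k i)]
  [∀ i, IsUltrametricDist (k i)] [∀ i, ProperSpace (k i)]

omit [DecidableEq I] [Nonempty I] [∀ i, IsUltrametricDist (k i)] [∀ i, ProperSpace (k i)] in
/-- **The packet maps to any field receiving all its factors**: `ℚ_p`-embeddings `φ_i : k_i → Ω` assemble to a
`ℚ_p`-algebra homomorphism `⊗φ_i : V = ⊗_{ℚ_p} k_i → Ω`, `⊗x_i ↦ ∏ φ_i(x_i)` (Mathlib `PiTensorProduct.liftAlgHom`).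
[cite: Mochizuki2012, IUTchIV Prop. 1.4 (i) p. 13] -/
theorem exists_algHom_of_algHom {Ω : Type} [Field Ω] [Algebra ℚ_[p] Ω] (φ : Π i, k i →ₐ[ℚ_[p]] Ω) :
    ∃ Φ : PacketAlgebra p k →ₐ[ℚ_[p]] Ω, ∀ x : Π i, k i, Φ (purePacket p k x) = ∏ i, φ i (x i) := by
  let f : MultilinearMap ℚ_[p] k Ω :=
    (MultilinearMap.mkPiAlgebra ℚ_[p] I Ω).compLinearMap fun i => (φ i).toLinearMap
  have hf : ∀ x : Π i, k i, f x = ∏ i, φ i (x i) := fun x => by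
    simp only [f, MultilinearMap.compLinearMap_apply, AlgHom.toLinearMap_apply, MultilinearMap.mkPiAlgebra_apply]
  refine ⟨PiTensorProduct.liftAlgHom f ?_ ?_, fun x => ?_⟩
  · rw [hf]
    exact Finset.prod_eq_one fun i _ => by rw [Pi.one_apply, map_one]
  · intro x y
    rw [hf, hf, hf, ← Finset.prod_mul_distrib]
    exact Finset.prod_congr rfl fun i _ => by rw [Pi.mul_apply, map_mul]
  · rw [purePacket, PiTensorProduct.liftAlgHom_apply, PiTensorProduct.lift.tprod, hf]

omit [DecidableEq I] [Nonempty I] [∀ i, IsUltrametricDist (k i)] in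
/-- **Some factor field of the packet embeds in any `p`-adic field receiving all the `k_i`**, hence has
different at most `d_Ω`: for `ℚ_p`-embeddings `φ_i : k_i → Ω` (`Ω` of the cell's norm-side class) there is `J`
with `d_{L_J} ≤ d_Ω` (`⊗φ_i ∘ ψ⁻¹ : ∏_J L_J → Ω` factors through an embedding `L_{J₀} → Ω`).
[cite: Mochizuki2012, IUTchIV Prop. 1.4 (i) p. 13] -/
theorem exists_differentOrd_dFac_le_of_algHom {Ω : Type} [NontriviallyNormedField Ω] [NormedAlgebra ℚ_[p] Ω]
    [IsUltrametricDist Ω] [ProperSpace Ω] (φ : Π i, k i →ₐ[ℚ_[p]] Ω) :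
    ∃ J : DIdx p k, differentOrd p (DFac p k J) ≤ differentOrd p Ω := by
  classical
  obtain ⟨Φ, -⟩ := exists_algHom_of_algHom p k φ
  let g : (Π J, DFac p k J) →ₐ[ℚ_[p]] Ω :=
    Φ.comp ((dEquiv p k).symm : (Π J, DFac p k J) ≃ₐ[ℚ_[p]] PacketAlgebra p k).toAlgHom
  obtain ⟨J₀, ⟨τ⟩⟩ := exists_nonempty_algHom_of_algHom_pi g
  exact ⟨J₀, differentOrd_le_of_algHom τ⟩

omit [DecidableEq I] [Nonempty I] [∀ i, IsUltrametricDist (k i)] in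
/-- **`min_J d_{L_J} ≤ d_Ω`** for every `p`-adic field `Ω` receiving all the factors.
[cite: Mochizuki2012, IUTchIV Prop. 1.4 (i) p. 13] -/
theorem inf_differentOrd_dFac_le_of_algHom {Ω : Type} [NontriviallyNormedField Ω] [NormedAlgebra ℚ_[p] Ω]
    [IsUltrametricDist Ω] [ProperSpace Ω] (φ : Π i, k i →ₐ[ℚ_[p]] Ω) :
    (Finset.univ : Finset (DIdx p k)).inf' Finset.univ_nonempty (fun J => differentOrd p (DFac p k J)) ≤
      differentOrd p Ω := by
  obtain ⟨J, hJ⟩ := exists_differentOrd_dFac_le_of_algHom p k φ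
  exact (Finset.inf'_le _ (Finset.mem_univ J)).trans hJ

/-! ## `d_{L_J} ≤ d_I` for every factor field -/

/-- **`d_{L_J} ≤ d_I` for EVERY factor field `L_J` of the packet** (`d_I = Σ_i d_i`). For a generator `g` of
`𝔇_{L_J}` the element `x = ψ⁻¹(0,…,g⁻¹,…,0)` satisfies `Tr_{V/ℚ_p}(x·y) = Tr_{L_J/ℚ_p}(g⁻¹·ψ_J(y)) ∈ ℤ_p` for all
`y ∈ R_I` (as `ψ_J(R_I) ⊆ O_{L_J}` and `𝔇_{L_J}⁻¹` is the trace dual of `O_{L_J}`); so the coordinates of `x` in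
the tensor basis `⊗c^{(i)}` dual to an integral tensor basis `⊗b^{(i)}` — which ARE the traces `Tr(x·⊗b^{(i)})` —
lie in `ℤ_p`, and since `(⊗δ_i)·⊗c^{(i)} ∈ R_I` ("the definition of the different", abc-iut-S5's
`norm_mul_le_one_of_traceDual`) we get `(⊗δ_i)·x ∈ R_I ⊆ (R_I)^∼`, whose `J`-component `∏σ_{iJ}(δ_i)·g⁻¹` must
have norm `≤ 1`: `p^{−d_I}·p^{d_{L_J}} ≤ 1`. [cite: Mochizuki2012, IUTchIV Prop. 1.1 p. 9]
[cite: SerreLocalFields1979, Ch. III §3] -/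
theorem differentOrd_dFac_le_dSum (J : DIdx p k) : differentOrd p (DFac p k J) ≤ dSum p k := by
  classical
  have hp : p.Prime := Fact.out
  have hp1 : (1 : ℝ) < p := by exact_mod_cast hp.one_lt
  have hp0 : (0 : ℝ) < p := by linarith
  -- generators of the differents
  have hgen := fun i => exists_different_eq_span p (k i)
  choose δ hδ using hgen
  obtain ⟨gJ, hgJ⟩ := exists_different_eq_span p (DFac p k J)
  have hδ0 : ∀ i, (δ i : k i) ≠ 0 := fun i => by exact_mod_cast generator_ne_zero p (k i) (hδ i)
  have hgJ0 : (gJ : DFac p k J) ≠ 0 := by exact_mod_cast generator_ne_zero p (DFac p k J) hgJ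
  -- integral bases and their trace duals
  have hbases := fun i => exists_integralBasis (p := p) (k i)
  choose n bZ bQ hb using hbases
  have hduals := fun i => exists_traceDual_basis (p := p) (bQ i)
  choose cQ hc using hduals
  let B := Basis.piTensorProduct bQ
  let C := Basis.piTensorProduct cQ
  -- the test element `x = ψ⁻¹(0,…,g⁻¹,…,0)`
  set x : PacketAlgebra p k := (dEquiv p k).symm (Pi.single J ((gJ : DFac p k J)⁻¹)) with hxdef
  -- Step 1: `Tr(x·y) ∈ ℤ_p` for `y ∈ R_I`
  have htr : ∀ y ∈ integerPacket p k, ‖Algebra.trace ℚ_[p] (PacketAlgebra p k) (x * y)‖ ≤ 1 := by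
    intro y hy
    have hyJ : ‖dEquiv p k y J‖ ≤ 1 := by
      have hmem : dEquiv p k y ∈ dEquiv p k '' (normalizedPacket p k : Set (PacketAlgebra p k)) :=
        ⟨y, integerPacket_le_normalizedPacket p k hy, rfl⟩
      rw [image_normalizedPacket_eq_coe, coe_piUnitBallStructure, mem_polydisc] at hmem
      exact hmem J
    rw [trace_eq_sum_trace_dEquiv]
    have hvan : ∀ J', J' ≠ J → dEquiv p k (x * y) J' = 0 := by
      intro J' hJ'
      rw [map_mul, hxdef, AlgEquiv.apply_symm_apply, Pi.mul_apply, Pi.single_eq_of_ne hJ', zero_mul]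
    have hat : dEquiv p k (x * y) J = ((gJ : DFac p k J))⁻¹ * dEquiv p k y J := by
      rw [map_mul, hxdef, AlgEquiv.apply_symm_apply, Pi.mul_apply, Pi.single_eq_same]
    rw [Fintype.sum_eq_single J (fun J' hJ' => by rw [hvan J' hJ', map_zero]), hat]
    exact norm_trace_generator_inv_mul_le_one p (DFac p k J) hgJ _ hyJ
  -- Step 2: the dual tensor basis coordinates of `x` are the traces against the integral tensor basis
  have hpair : ∀ κ κ' : Π i, Fin (n i),
      Algebra.trace ℚ_[p] (PacketAlgebra p k) (C κ * B κ') = if κ' = κ then 1 else 0 := by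
    intro κ κ'
    rw [Basis.piTensorProduct_apply, Basis.piTensorProduct_apply,
      show (⨂ₜ[ℚ_[p]] i, (cQ i) (κ i)) = purePacket p k (fun i => cQ i (κ i)) from rfl,
      show (⨂ₜ[ℚ_[p]] i, (bQ i) (κ' i)) = purePacket p k (fun i => bQ i (κ' i)) from rfl,
      purePacket_mul, trace_purePacket]
    simp only [Pi.mul_apply, hc]
    by_cases hκ : κ' = κ
    · subst hκ
      rw [if_pos rfl]
      exact Finset.prod_eq_one fun i _ => by rw [if_pos rfl]
    · rw [if_neg hκ]
      have : ∃ i, κ' i ≠ κ i := by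
        by_contra h
        push Not at h
        exact hκ (funext h)
      obtain ⟨i, hi⟩ := this
      exact Finset.prod_eq_zero (Finset.mem_univ i) (by rw [if_neg hi])
  have hcoord : ∀ κ : Π i, Fin (n i), C.repr x κ = Algebra.trace ℚ_[p] (PacketAlgebra p k) (x * B κ) := by
    intro κ
    conv_rhs => rw [← C.sum_repr x]
    rw [Finset.sum_mul, map_sum]
    simp_rw [smul_mul_assoc, LinearMap.map_smul, hpair, smul_eq_mul, mul_ite, mul_one, mul_zero]
    rw [Finset.sum_ite_eq Finset.univ κ, if_pos (Finset.mem_univ κ)]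
  have hcoordZ : ∀ κ : Π i, Fin (n i), ‖C.repr x κ‖ ≤ 1 := by
    intro κ
    rw [hcoord]
    refine htr _ ?_
    rw [Basis.piTensorProduct_apply]
    exact purePacket_mem_integerPacket p k fun i => norm_basis_le_one (bZ i) (bQ i) (hb i) (κ i)
  -- hence `(⊗δ)·x ∈ R_I`
  have hDx : purePacket p k (fun i => (δ i : k i)) * x ∈ integerPacket p k := by
    rw [← C.sum_repr x, Finset.mul_sum]
    refine sum_mem fun κ _ => ?_
    rw [mul_smul_comm]
    refine smul_mem_integerPacket p k (hcoordZ κ) ?_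
    rw [Basis.piTensorProduct_apply, show (⨂ₜ[ℚ_[p]] i, (cQ i) (κ i)) =
      purePacket p k (fun i => cQ i (κ i)) from rfl, purePacket_mul]
    exact purePacket_mem_integerPacket p k fun i =>
      norm_mul_le_one_of_traceDual (bZ i) (bQ i) (hb i) (cQ i) (hc i) (hδ i) (κ i)
  -- Step 3: read the `J`-component of `ψ((⊗δ)·x) ∈ ∏ O_{L_J'}`
  have hmem : dEquiv p k (purePacket p k (fun i => (δ i : k i)) * x) ∈
      dEquiv p k '' (normalizedPacket p k : Set (PacketAlgebra p k)) :=
    ⟨_, integerPacket_le_normalizedPacket p k hDx, rfl⟩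
  rw [image_normalizedPacket_eq_coe, coe_piUnitBallStructure, mem_polydisc] at hmem
  have hJle := hmem J
  rw [map_mul, Pi.mul_apply, hxdef, AlgEquiv.apply_symm_apply, Pi.single_eq_same, norm_mul, norm_inv] at hJle
  have hnormδ : ‖dEquiv p k (purePacket p k (fun i => (δ i : k i))) J‖ = (p : ℝ) ^ (-dSum p k) := by
    rw [psi_purePacket_apply, norm_prod, dSum, ← Finset.sum_neg_distrib, Real.rpow_sum_of_pos hp0]
    refine Finset.prod_congr rfl fun i _ => ?_
    rw [norm_factorEmb, norm_eq_rpow_neg_differentOrd p (k i) (hδ i) (generator_ne_zero p (k i) (hδ i))]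
  have hnormJ : ‖(gJ : DFac p k J)‖ = (p : ℝ) ^ (-differentOrd p (DFac p k J)) :=
    norm_eq_rpow_neg_differentOrd p (DFac p k J) hgJ (generator_ne_zero p (DFac p k J) hgJ)
  rw [hnormδ, hnormJ, ← Real.rpow_neg hp0.le, neg_neg, ← Real.rpow_add hp0] at hJle
  -- `p^{d_J − d_I} ≤ 1 = p^0`
  rw [← Real.rpow_zero (p : ℝ), Real.rpow_le_rpow_left_iff hp1] at hJle
  linarith

/-- **`min_J d_{L_J} ≤ d_{L_J} ≤ d_I`**. [cite: Mochizuki2012, IUTchIV Prop. 1.1 p. 9] -/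
theorem inf_differentOrd_dFac_le_dSum :
    (Finset.univ : Finset (DIdx p k)).inf' Finset.univ_nonempty (fun J => differentOrd p (DFac p k J)) ≤
      dSum p k := by
  obtain ⟨J⟩ := (inferInstance : Nonempty (DIdx p k))
  exact (Finset.inf'_le _ (Finset.mem_univ J)).trans (differentOrd_dFac_le_dSum p k J)

end Packet

/-! ## The two instances used at the collections `v⃗` of [IUTchIV] Thm. 1.10 Step (v) -/

section Instances

variable (p : ℕ) [Fact p.Prime]

/-- **(a) `j+1` copies of ONE field**: for the constant family `k_i = K` some factor field of `⊗_{i∈I} K` embeds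
in `K` (the multiplication map `⊗K → K`), so `min_J d_{L_J} ≤ d_K` — whether or not `K/ℚ_p` is Galois.
[cite: Mochizuki2012, IUTchIV Prop. 1.4 (i) p. 13] -/
theorem inf_differentOrd_dFac_const_le {I : Type} [Fintype I] [DecidableEq I] [Nonempty I]
    (K : Type) [NontriviallyNormedField K] [NormedAlgebra ℚ_[p] K] [IsUltrametricDist K] [ProperSpace K] :
    (Finset.univ : Finset (DIdx p (fun _ : I => K))).inf' Finset.univ_nonempty
        (fun J => differentOrd p (DFac p (fun _ : I => K) J)) ≤ differentOrd p K :=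
  inf_differentOrd_dFac_le_of_algHom p (fun _ : I => K) fun _ => AlgHom.id ℚ_[p] K

variable {U : Type} [Fintype U] [DecidableEq U] [Nonempty U]
variable (k₁ : U → Type) [∀ u, NontriviallyNormedField (k₁ u)] [∀ u, NormedAlgebra ℚ_[p] (k₁ u)]
  [∀ u, IsUltrametricDist (k₁ u)] [∀ u, ProperSpace (k₁ u)]

omit [Nonempty U] [∀ u, IsUltrametricDist (k₁ u)] in
/-- **(b) a family drawn from a finite stock**: for `k = k₁ ∘ e` (`e : I → U`; e.g. a collection `v⃗ = (v_b)_b` of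
places of `F₀` over `p`, `k₁ u = K_{u̲}`), every factor field `L'_{J₁}` of the ONE-COPY packet `⊗_{u∈U} k₁ u` receives
all the `k₁ (e b)` (the component embeddings `σ_{u J₁}`), so `min_J d_{L_J}(k₁ ∘ e) ≤ d_{L'_{J₁}}`.
[cite: Mochizuki2012, IUTchIV Prop. 1.4 (i) p. 13] -/
theorem inf_differentOrd_dFac_comp_le_dFac {I : Type} [Fintype I] [DecidableEq I] [Nonempty I] (e : I → U)
    (J₁ : DIdx p k₁) :
    (Finset.univ : Finset (DIdx p (fun b => k₁ (e b)))).inf' Finset.univ_nonempty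
        (fun J => differentOrd p (DFac p (fun b => k₁ (e b)) J)) ≤ differentOrd p (DFac p k₁ J₁) :=
  inf_differentOrd_dFac_le_of_algHom p (fun b => k₁ (e b)) fun b =>
    factorEmb p k₁ (DFac p k₁) (dEquiv p k₁) (e b) J₁

/-- **(b′) … hence `min_J d_{L_J}(k₁ ∘ e) ≤ Σ_{u∈U} d(k₁ u)`, UNIFORMLY in the collection `e`** (take any factor
field of the one-copy packet and `differentOrd_dFac_le_dSum` there). At the collections of [IUTchIV] Thm. 1.10
Step (v) over a prime `p`: `min_J d_{L_J}(v⃗) ≤ Σ_{u∈V(F₀)_p} d(K_{u̲})` for every `v⃗ ∈ V(F₀)_p^{j+1}`.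
[cite: Mochizuki2012, IUTchIV Prop. 1.1 p. 9, Prop. 1.4 (i) p. 13] -/
theorem inf_differentOrd_dFac_comp_le_dSum {I : Type} [Fintype I] [DecidableEq I] [Nonempty I] (e : I → U) :
    (Finset.univ : Finset (DIdx p (fun b => k₁ (e b)))).inf' Finset.univ_nonempty
        (fun J => differentOrd p (DFac p (fun b => k₁ (e b)) J)) ≤ dSum p k₁ := by
  obtain ⟨J₁⟩ := (inferInstance : Nonempty (DIdx p k₁))
  exact (inf_differentOrd_dFac_comp_le_dFac p k₁ e J₁).trans (differentOrd_dFac_le_dSum p k₁ J₁)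

end Instances

end Literature.IUT.LogVolume

end
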